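import Summits.Ventures.PercRepro.ProfileBiIndepNormConsColoop
import Mathlib.Combinatorics.SetFamily.Shadow

/-!
# PercRepro — THE TWO-MATROID FORM (NC-pair) OF (NC), AND THE INDEPENDENCE-COMPLEX STATEMENT (NMP-I), AS PROPS
(p10, gen 29; proofs/P10-NC-g29.md §3)

For two matroids `M₁, M₂` on one ground set let `BI_j(M₁, M₂) = {X : #X = j, X ∈ I(M₁), E ∖ X ∈ I(M₂)}` (`mixedBiIndepSets`)
and, for an up-set `U` of flats of `M₁`, `u_j = #{X ∈ BI_j(M₁,M₂) : cl₁ X ∈ U}` (`mixedUpCount`).  Deleting / contracting an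
element splits `BI_j(M₁,M₂)` into `BI_j(M₁∖f, M₂/f)` and `BI_{j−1}(M₁/f, M₂∖f) + f`, so the class of pairs is closed under the
recursion that a proof of (NC) by induction on `#E` would run; for `M₁ = M₂ = M` the pairs that arise are the fibres
`{Z : Z ∩ A = ∅, B ⊆ Z}` of the bi-independent complex of `M`.
* **CONJECTURE (NC-pair)** (`NormConsPair`, NOT asserted): `u_j · #BI_{j+1} ≤ u_{j+1} · #BI_j` for every pair, every up-set of
  flats of `M₁` and every level — DATA: 0 failures on every ordered pair of matroids on `≤ 5` elements under all permutations
  (173,280 pairs at `n = 5`), 192,080 pairs at `n = 6`, 93,636 pairs at `n = 7` (random permutations), every sub-cube fibre of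
  every matroid `n ≤ 6`; `normCons_of_normConsPair`: (NC-pair) ⟹ (NC) (`mixedBiIndepSets_self`).
* **CONJECTURE (NMP-I)** (`IndepNMP`, NOT asserted): the independence complex of every matroid has the normalised matching
  property, `#𝒜 · #I_j ≤ #∂𝒜 · #I_{j+1}` for every `𝒜 ⊆ I_{j+1}` (Mathlib's `Finset.shadow`) — the case `M₁ = free` of
  (NC-pair) by complementation; equivalently uniform independent `(j+1)`-sets stochastically dominate uniform independent
  `j`-sets — DATA: 0 failures on every matroid `n ≤ 9` (1,724,274 tests at `n = 9`, kit j299139, engine twin 1117).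
Nothing here asserts (NC-pair), (NMP-I) or (NC).
-/

open scoped Matroid

namespace PercRepro.Cogirth

open Finset ThmH Skew

variable {α : Type} [DecidableEq α]

/-- The mixed bi-independent `j`-sets of the pair `(M₁, M₂)`, on the ground set of `M₁`: `X ∈ I(M₁)` and `E ∖ X ∈ I(M₂)`. -/
noncomputable def mixedBiIndepSets (M₁ M₂ : Matroid α) [M₁.Finite] [M₂.Finite] (j : ℕ) : Finset (Finset α) :=
  (gr M₁).powerset.filter (fun X => X.card = j ∧ rk M₁ X = X.card ∧ rk M₂ (gr M₁ \ X) = (gr M₁ \ X).card)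

/-- The pair `(M, M)` gives the bi-independent sets of `M`. -/
theorem mixedBiIndepSets_self (M : Matroid α) [M.Finite] (j : ℕ) : mixedBiIndepSets M M j = biIndepSets M j :=
  rfl

/-- The mixed bi-independent `j`-sets whose `M₁`-closure lies in `U`. -/
noncomputable def mixedUpCount (M₁ M₂ : Matroid α) [M₁.Finite] [M₂.Finite] (U : Finset (Finset α)) (j : ℕ) : ℕ :=
  ((mixedBiIndepSets M₁ M₂ j).filter (fun X => clF M₁ X ∈ U)).card

/-- The pair `(M, M)` gives `u_j(U)`. -/
theorem mixedUpCount_self (M : Matroid α) [M.Finite] (U : Finset (Finset α)) (j : ℕ) :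
    mixedUpCount M M U j = upCount M U j :=
  rfl

/-- **CONJECTURE (NC-pair) (NOT asserted)**: for every two finite matroids on one ground set, every up-set `U` of flats of
the first and every level `j`, `u_j(U) · #BI_{j+1}(M₁,M₂) ≤ u_{j+1}(U) · #BI_j(M₁,M₂)`. -/
def NormConsPair (α : Type) [DecidableEq α] : Prop :=
  ∀ (M₁ M₂ : Matroid α) [M₁.Finite] [M₂.Finite], gr M₁ = gr M₂ →
    ∀ (U : Finset (Finset α)), UpFlats M₁ U → ∀ j : ℕ,
      mixedUpCount M₁ M₂ U j * (mixedBiIndepSets M₁ M₂ (j + 1)).card ≤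
        mixedUpCount M₁ M₂ U (j + 1) * (mixedBiIndepSets M₁ M₂ j).card

/-- (NC-pair) ⟹ (NC): the pair `(M, M)`. -/
theorem normCons_of_normConsPair (h : NormConsPair α) : NormCons α := by
  intro M _ U hU j
  have h1 := h M M rfl U hU j
  rw [mixedUpCount_self, mixedUpCount_self, mixedBiIndepSets_self, mixedBiIndepSets_self] at h1
  exact h1

/-- The independent `j`-sets of `M`. -/
noncomputable def indepSetsF (M : Matroid α) [M.Finite] (j : ℕ) : Finset (Finset α) :=
  ((gr M).powersetCard j).filter (fun X => rk M X = X.card)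

/-- **CONJECTURE (NMP-I) (NOT asserted)**: the independence complex of every finite matroid on `α` has the normalised
matching property between consecutive levels: `#𝒜 · #I_j ≤ #∂𝒜 · #I_{j+1}` for every `𝒜 ⊆ I_{j+1}`. -/
def IndepNMP (α : Type) [DecidableEq α] : Prop :=
  ∀ (M : Matroid α) [M.Finite] (j : ℕ) (𝒜 : Finset (Finset α)), 𝒜 ⊆ indepSetsF M (j + 1) →
    𝒜.card * (indepSetsF M j).card ≤ (shadow 𝒜).card * (indepSetsF M (j + 1)).card

/-- The shadow of a family of independent `(j+1)`-sets consists of independent `j`-sets. -/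
theorem shadow_subset_indepSetsF (M : Matroid α) [M.Finite] {j : ℕ} {𝒜 : Finset (Finset α)}
    (h𝒜 : 𝒜 ⊆ indepSetsF M (j + 1)) : shadow 𝒜 ⊆ indepSetsF M j := by
  intro X hX
  rw [mem_shadow_iff] at hX
  obtain ⟨Y, hY, a, ha, rfl⟩ := hX
  have hY' := h𝒜 hY
  unfold indepSetsF at hY' ⊢
  rw [mem_filter, mem_powersetCard] at hY' ⊢
  obtain ⟨⟨hYg, hYc⟩, hYr⟩ := hY'
  refine ⟨⟨(erase_subset _ _).trans hYg, by rw [card_erase_of_mem ha, hYc]; rfl⟩, ?_⟩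
  exact rk_eq_card_of_subset_of_rk_eq_card (erase_subset a Y) hYr

end PercRepro.Cogirth
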